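import Literature.AlgebraicGeometry.Resolution.FormalBranchesModel
import Literature.AlgebraicGeometry.Resolution.FormalNormalCrossingsAlgebra
import Literature.AlgebraicGeometry.Resolution.StrictNormalCrossingsLocalDescent
import Mathlib.RingTheory.Etale.QuasiFinite
import Mathlib.RingTheory.Flat.Localization
import Mathlib.RingTheory.Flat.Stability
import Mathlib.RingTheory.IsTensorProduct
import Mathlib.RingTheory.TensorProduct.Quotient
import Mathlib.RingTheory.TensorProduct.Pi
import Mathlib.RingTheory.LocalRing.ResidueField.Ideal
import Mathlib.RingTheory.Localization.AtPrime.Basic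
import HarnessLib

/-!
# Étale-local splitting of formal branches: strict normal crossings descend from a formal
branch decomposition

Topic: `Literature/AlgebraicGeometry/Resolution`. Third file of the Artin-approximation-free
proof that FORMAL normal crossings are étale-local normal crossings (de Jong 1996, between
4.25 (i) and 4.28/2.4; the named fact `DeJong1996FormalNormalCrossings` of
`AlterationsNormalFormBlowup.lean`), after `FormalBranchesModel.lean` (the generic chart of the
blow-up of the double locus of `x₁ ⋯ x_r = 0` in a regular local ring `P` IS the product of the
branch rings `Π_{j<r} P/(xⱼ)`). Everything here is PROVED; no named facts.

## The theorem (`exists_etale_isSNCIdeal_of_branchDecomposition`)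

Let `A` be a Noetherian local ring and `Ah` a regular local `A`-algebra which is flat, with local
structure map and "the same residue field" in the strong sense that every element of `Ah` is
congruent modulo `𝔪_{Ah}` to an element of `A` (the completion `Â` of `A` is the case in point);
let `x₁, …, x_d` generate `𝔪_{Ah}`, `dim Ah = d`, `1 ≤ r ≤ d`; let `C` be a finite `A`-algebra
with an `Ah`-algebra isomorphism `Φ : Ah ⊗_A C ≅ Π_{j<r} Ah/(xⱼ)` (in the application: the affine
blow-up chart of the double locus of the divisor, `branchModelEquiv`, whose formation commutes
with the flat base change `A → Â`); and let `I ⊆ A` be an ideal with `I·Ah = (x₁ ⋯ x_r)`. Then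
there is an étale `A`-algebra `R'` and a prime `P` over `𝔪_A` with `A → κ(P)` onto such that
`I·R'_P` has local strict normal crossings data (`IsSNCIdeal`, `StrictNormalCrossingsAt.lean`).

## Proof

1. (Mathlib, Stacks 00UL) `Algebra.exists_etale_completeOrthogonalIdempotents_forall_liesOver_eq`
   splits the finite `A`-algebra `C` étale-locally: an étale `R'`, a prime `P` over `𝔪_A` with
   `κ(𝔪_A) ≅ κ(P)`, complete orthogonal idempotents `e₀, …, e_n` of `R' ⊗_A C` and the list
   `P'ᵢ` of ALL primes over `P`, `P'ᵢ` being the unique prime over `P` avoiding `eᵢ`.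
2. `B'' = (Ah ⊗_A R')_{P̂}` with `P̂ = ker (Ah ⊗_A R' → κ(P))` (`theta`, `PHat`, `Bpp`) is étale
   local over `Ah`: regular, `𝔪_{B''} = 𝔪_{Ah} B''`, `dim B'' = d` (tree
   `FormalNormalCrossingsAlgebra.lean`), so the `x̄ᵢ` form a regular system of parameters of `B''`;
   it is flat (`Ah` flat over `A`) and local over `A' = R'_P`, and `A → κ(B'')` is onto.
3. `Ψ = B'' ⊗_{Ah} Φ : B'' ⊗_A C ≅ Π_j B''/(x̄ⱼ)` (`Psi`, `proj`). The `j`-th branch point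
   `𝔔_j = ker (B'' ⊗_A C → B''/(x̄ⱼ) → κ(B''))` pulls back to a prime `Q_j` of `R' ⊗_A C` over `P`
   and to a prime `𝔫_j` of `C`; the `𝔫_j` are pairwise distinct (`nb_injective`: approximate a
   preimage of the `j`-th unit vector by `1 ⊗ c`, using `A ↠ κ(B'')`).
4. For each `j` some `e_{i₀} ∉ Q_j`, so `Q_j = P'_{i₀}`; the idempotent `ε = τ(e_{i₀})` of
   `B'' ⊗_A C` then has `π_j ε = 1` and `π_l ε = 0` for `l ≠ j` — if `π_l ε = 1` then
   `Q_l = P'_{i₀} = Q_j` by uniqueness, whence `𝔫_l = 𝔫_j` (`exists_proj_tau_eq`). Hence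
   `ker (B'' → (B'' ⊗_A C)/(1 - ε)) = (x̄ⱼ)` (`ker_algebraMap_quotient_eq_span`).
5. With `D = (R' ⊗_A C)/(1 - e_{i₀})` and `𝔞 = ker (R' → D)`: `B'' ⊗_{R'} D ≅ (B'' ⊗_A C)/(1 - ε)`
   and, `R' → B''` being flat, `ker (B'' → B'' ⊗_{R'} D) = 𝔞 B''`
   (`ker_algebraMap_tensorProduct_of_flat`). So every branch ideal `(x̄ⱼ) ⊂ B''` is extended
   from `R'`, hence from `A'` (`exists_ideal_map_eq_span_xb`).
6. Strict normal crossings descend along the flat local `A' → B''`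
   (`exists_rsop_prod_of_flat`, `StrictNormalCrossingsLocalDescent.lean`):
   `isSNCIdeal_map_of_splitting`.

`Bpp` is a type synonym (a `def`) of the localisation: tensoring a localisation of a tensor
product once more defeats Mathlib's instance search (two module structures), and the synonym
restores a unique instance path.

## Sources

* A. J. de Jong, *Smoothness, semi-stability and alterations*, Publ. Math. IHÉS 83 (1996),
  2.4, 4.25 (i), 4.28 (the statement served). [DeJong1996]
* The Stacks Project, Tag 00UL (étale localisation of finite algebras; through Mathlib),
  Tags 00TV, 00UW, 00ON (étale local algebras), Tag 0CB4/0BSF context. [StacksProject]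
* H. Matsumura, *Commutative Ring Theory* (1986), Thm. 7.5 (faithfully flat descent of
  ideals), Thm. 23.7. [Matsumura1987]
-/

noncomputable section

open IsLocalRing TensorProduct

namespace Literature.AlgebraicGeometry.Resolution

universe u

/-! ## General lemma: kernels of base-changed structure maps along a flat algebra -/

section KerFlat

variable {R B D : Type*} [CommRing R] [CommRing B] [CommRing D] [Algebra R B] [Algebra R D]

/-- **Kernels of structure maps commute with flat base change**: for `R → B` flat and an
`R`-algebra `D`, the kernel of `B → B ⊗_R D` is the extension of the kernel of `R → D`
(`B ⊗_R D ⊇ B ⊗_R (R/𝔞) = B/𝔞B` by flatness, `𝔞 = ker (R → D)`). [folklore] -/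
theorem ker_algebraMap_tensorProduct_of_flat [Module.Flat R B] :
    RingHom.ker (algebraMap B (B ⊗[R] D)) =
      (RingHom.ker (algebraMap R D)).map (algebraMap R B) := by
  set 𝔞 : Ideal R := RingHom.ker (algebraMap R D) with h𝔞
  apply le_antisymm
  · intro b hb
    rw [RingHom.mem_ker] at hb
    -- `R/𝔞 → D` is injective, hence so is `B ⊗ R/𝔞 → B ⊗ D`
    let ι : (R ⧸ 𝔞) →ₐ[R] D := Ideal.Quotient.liftₐ 𝔞 (Algebra.ofId R D) fun a ha => ha
    have hι : Function.Injective ι := by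
      rw [injective_iff_map_eq_zero]
      intro a ha
      obtain ⟨a, rfl⟩ := Ideal.Quotient.mk_surjective a
      exact Ideal.Quotient.eq_zero_iff_mem.mpr ha
    have hinj : Function.Injective (LinearMap.lTensor B ι.toLinearMap) :=
      Module.Flat.lTensor_preserves_injective_linearMap (M := B) ι.toLinearMap hι
    -- the class of `b` in `B/𝔞B ≅ B ⊗ R/𝔞` maps to `b ⊗ 1 = 0`
    have h1 : LinearMap.lTensor B ι.toLinearMap (b ⊗ₜ[R] (1 : R ⧸ 𝔞)) = 0 := by
      rw [LinearMap.lTensor_tmul, AlgHom.toLinearMap_apply, map_one]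
      exact hb
    have h2 : (b ⊗ₜ[R] (1 : R ⧸ 𝔞) : B ⊗[R] (R ⧸ 𝔞)) = 0 := hinj (by rw [h1, map_zero])
    have h3 : (Algebra.TensorProduct.quotIdealMapEquivTensorQuot B 𝔞)
        (Ideal.Quotient.mk (𝔞.map (algebraMap R B)) b) = 0 := by
      rw [Algebra.TensorProduct.quotIdealMapEquivTensorQuot_mk]
      exact h2
    rw [EmbeddingLike.map_eq_zero_iff, Ideal.Quotient.eq_zero_iff_mem] at h3
    exact h3
  · rw [Ideal.map_le_iff_le_comap]
    intro a ha
    rw [Ideal.mem_comap, RingHom.mem_ker, Algebra.TensorProduct.algebraMap_apply,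
      Algebra.algebraMap_self, RingHom.id_apply,
      ← mul_one (algebraMap R B a), ← Algebra.smul_def, TensorProduct.smul_tmul,
      Algebra.smul_def, mul_one, RingHom.mem_ker.mp ha, TensorProduct.tmul_zero]

end KerFlat

/-! ## The setting: a local ring, a faithfully flat regular local model of its completion,
an étale neighbourhood -/

section Setting

variable {A : Type u} [CommRing A] [IsLocalRing A]
variable {Ah : Type u} [CommRing Ah] [Algebra A Ah] [IsLocalRing Ah] [IsLocalHom (algebraMap A Ah)]
variable {R' : Type u} [CommRing R'] [Algebra A R'] (P : Ideal R') [P.IsPrime]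
  [P.LiesOver (maximalIdeal A)]

/-- The residue field of `Ah` is that of `A` when every element of `Ah` is congruent to an
element of `A` modulo `𝔪_{Ah}` (as for the completion of a Noetherian local ring). [folklore] -/
theorem residueField_map_bijective_of_approx
    (happrox : ∀ y : Ah, ∃ a : A, y - algebraMap A Ah a ∈ maximalIdeal Ah) :
    Function.Bijective (ResidueField.map (algebraMap A Ah)) := by
  refine ⟨RingHom.injective _, fun z => ?_⟩
  obtain ⟨y, rfl⟩ := residue_surjective z
  obtain ⟨a, ha⟩ := happrox y
  refine ⟨residue A a, ?_⟩
  rw [ResidueField.map_residue, ← sub_eq_zero, ← map_sub, residue_eq_zero_iff]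
  have : algebraMap A Ah a - y = -(y - algebraMap A Ah a) := by ring
  rw [this]
  exact Submodule.neg_mem _ ha

variable (happrox : ∀ y : Ah, ∃ a : A, y - algebraMap A Ah a ∈ maximalIdeal Ah)

/-- The residue isomorphism `κ(A) ≅ κ(Ah)`. [folklore] -/
def residueEquiv : ResidueField A ≃+* ResidueField Ah :=
  RingEquiv.ofBijective _ (residueField_map_bijective_of_approx happrox)

omit [P.IsPrime] in
/-- `κ(A) → κ(P)` for a prime `P` of an `A`-algebra over `𝔪_A`. [folklore] -/
def residueToResidueField : ResidueField A →+* P.ResidueField :=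
  Ideal.Quotient.lift (maximalIdeal A) (algebraMap A P.ResidueField) fun a ha => by
    rw [IsScalarTower.algebraMap_apply A R' P.ResidueField, Ideal.algebraMap_residueField_eq_zero]
    have : a ∈ P.under A := by rwa [← P.over_def (maximalIdeal A)]
    exact this

/-- The `A`-algebra map `Ah → κ(Ah) ≅ κ(A) → κ(P)`. [folklore] -/
def completionToResidueField : Ah →ₐ[A] P.ResidueField where
  toRingHom := ((residueToResidueField P).comp (residueEquiv happrox).symm.toRingHom).comp
    (residue Ah)
  commutes' a := by
    change residueToResidueField P ((residueEquiv happrox).symm (residue Ah (algebraMap A Ah a))) =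
      algebraMap A P.ResidueField a
    have h1 : (residueEquiv happrox).symm (residue Ah (algebraMap A Ah a)) = residue A a := by
      rw [RingEquiv.symm_apply_eq]
      change _ = ResidueField.map (algebraMap A Ah) (residue A a)
      rw [ResidueField.map_residue]
    rw [h1]
    rfl

/-- `θ : Ah ⊗_A R' → κ(P)`, `y ⊗ r ↦ ȳ · r̄`. [folklore] -/
def theta : Ah ⊗[A] R' →ₐ[A] P.ResidueField :=
  Algebra.TensorProduct.lift (completionToResidueField P happrox)
    (IsScalarTower.toAlgHom A R' P.ResidueField) fun _ _ => Commute.all _ _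

/-- `θ(y ⊗ s) = ȳ · s̄`. [folklore] -/
theorem theta_tmul (y : Ah) (s : R') :
    theta P happrox (y ⊗ₜ s) = completionToResidueField P happrox y * algebraMap R' _ s :=
  Algebra.TensorProduct.lift_tmul _ _ _ y s

/-- `Ah → κ(P)` has kernel `𝔪_{Ah}`. [folklore] -/
theorem completionToResidueField_eq_zero_iff (y : Ah) :
    completionToResidueField P happrox y = 0 ↔ y ∈ maximalIdeal Ah := by
  change residueToResidueField P ((residueEquiv happrox).symm (residue Ah y)) = 0 ↔ _
  rw [map_eq_zero_iff _ (RingHom.injective _), EmbeddingLike.map_eq_zero_iff, residue_eq_zero_iff]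

/-- The prime `P̂ = ker θ` of `Ah ⊗_A R'`. [folklore] -/
def PHat : Ideal (Ah ⊗[A] R') := RingHom.ker (theta P happrox).toRingHom

/-- `P̂` is prime (its residue ring embeds in a field). [folklore] -/
instance isPrime_PHat : (PHat P happrox).IsPrime := RingHom.ker_isPrime _

/-- Membership in `P̂`. [folklore] -/
theorem mem_PHat_iff (t : Ah ⊗[A] R') : t ∈ PHat P happrox ↔ theta P happrox t = 0 := Iff.rfl

/-- `P̂ ∩ Ah = 𝔪_{Ah}`. [folklore] -/
theorem comap_PHat_left :
    (PHat P happrox).comap (algebraMap Ah (Ah ⊗[A] R')) = maximalIdeal Ah := by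
  ext y
  rw [Ideal.mem_comap, mem_PHat_iff, Algebra.TensorProduct.algebraMap_apply,
    Algebra.algebraMap_self, RingHom.id_apply, theta_tmul, map_one, mul_one,
    completionToResidueField_eq_zero_iff]

/-- `P̂ ∩ R' = P`. [folklore] -/
theorem comap_PHat_right :
    (PHat P happrox).comap (Algebra.TensorProduct.includeRight (R := A) (A := Ah)).toRingHom = P := by
  ext s
  rw [Ideal.mem_comap, AlgHom.toRingHom_eq_coe, AlgHom.coe_toRingHom,
    Algebra.TensorProduct.includeRight_apply, mem_PHat_iff, theta_tmul, map_one, one_mul,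
    Ideal.algebraMap_residueField_eq_zero]

/-- `θ` is onto when `A → κ(P)` is. [folklore] -/
theorem theta_surjective (hsurjP : Function.Surjective (algebraMap A P.ResidueField)) :
    Function.Surjective (theta P happrox) := fun z => by
  obtain ⟨a, rfl⟩ := hsurjP z
  exact ⟨algebraMap A _ a, AlgHom.commutes _ a⟩

/-- The local ring `B'' = (Ah ⊗_A R')_{P̂}`. It is a type synonym of the localisation (a plain
`def`, not an `abbrev`): tensoring a localisation of a tensor product once more confuses
Mathlib's instance search (two module structures on the localisation), and the synonym with
its own instances restores a unique path. [folklore] -/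
def Bpp : Type u := Localization.AtPrime (PHat P happrox)

/-- The ring structure of `B''` (that of the localisation). [folklore] -/
instance : CommRing (Bpp P happrox) := inferInstanceAs (CommRing (Localization.AtPrime (PHat P happrox)))

/-- `Ah ⊗_A R' → B''`. [folklore] -/
instance : Algebra (Ah ⊗[A] R') (Bpp P happrox) :=
  inferInstanceAs (Algebra (Ah ⊗[A] R') (Localization.AtPrime (PHat P happrox)))

/-- `B''` is the localisation of `Ah ⊗_A R'` at `P̂`. [folklore] -/
instance : IsLocalization.AtPrime (Bpp P happrox) (PHat P happrox) :=
  inferInstanceAs (IsLocalization.AtPrime (Localization.AtPrime (PHat P happrox)) (PHat P happrox))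

/-- `B''` is local. [folklore] -/
instance : IsLocalRing (Bpp P happrox) :=
  inferInstanceAs (IsLocalRing (Localization.AtPrime (PHat P happrox)))

/-- `A → B''`. [folklore] -/
instance : Algebra A (Bpp P happrox) := inferInstanceAs (Algebra A (Localization.AtPrime (PHat P happrox)))

/-- `Ah → B''`. [folklore] -/
instance : Algebra Ah (Bpp P happrox) := inferInstanceAs (Algebra Ah (Localization.AtPrime (PHat P happrox)))

/-- `A → Ah ⊗_A R' → B''` commutes. [folklore] -/
instance : IsScalarTower A (Ah ⊗[A] R') (Bpp P happrox) :=
  inferInstanceAs (IsScalarTower A (Ah ⊗[A] R') (Localization.AtPrime (PHat P happrox)))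

/-- `Ah → Ah ⊗_A R' → B''` commutes. [folklore] -/
instance : IsScalarTower Ah (Ah ⊗[A] R') (Bpp P happrox) :=
  inferInstanceAs (IsScalarTower Ah (Ah ⊗[A] R') (Localization.AtPrime (PHat P happrox)))

/-- `A → Ah → B''` commutes. [folklore] -/
instance : IsScalarTower A Ah (Bpp P happrox) :=
  inferInstanceAs (IsScalarTower A Ah (Localization.AtPrime (PHat P happrox)))

/-- `R' → B''`, `s ↦ (1 ⊗ s)/1`. [folklore] -/
def toBpp : R' →ₐ[A] Bpp P happrox :=
  (IsScalarTower.toAlgHom A (Ah ⊗[A] R') (Bpp P happrox)).comp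
    (Algebra.TensorProduct.includeRight (R := A) (A := Ah))

/-- Unfolding `toBpp`. [folklore] -/
theorem toBpp_apply (s : R') :
    toBpp P happrox s = algebraMap (Ah ⊗[A] R') (Bpp P happrox) (1 ⊗ₜ s) := rfl

/-- The local homomorphism `A' = R'_P → B''`. [folklore] -/
def locToBpp : Localization.AtPrime P →+* Bpp P happrox :=
  Localization.localRingHom P (PHat P happrox)
    (Algebra.TensorProduct.includeRight (R := A) (A := Ah)).toRingHom (comap_PHat_right P happrox).symm

/-- `A' → B''` is a local homomorphism. [folklore] -/
instance : IsLocalHom (locToBpp P happrox) :=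
  Localization.isLocalHom_localRingHom P (PHat P happrox) _ (comap_PHat_right P happrox).symm

/-- `A' → B''` extends `R' → B''`. [folklore] -/
theorem locToBpp_algebraMap (s : R') :
    locToBpp P happrox (algebraMap R' (Localization.AtPrime P) s) = toBpp P happrox s :=
  Localization.localRingHom_to_map _ _ _ _ s

/-- Every element of `B''` is congruent to an element of `A` modulo `𝔪_{B''}`. [folklore] -/
theorem exists_sub_algebraMap_mem_maximalIdeal_Bpp
    (hsurjP : Function.Surjective (algebraMap A P.ResidueField)) (b : Bpp P happrox) :
    ∃ a : A, b - algebraMap A (Bpp P happrox) a ∈ maximalIdeal (Bpp P happrox) := by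
  obtain ⟨⟨t, s⟩, rfl⟩ := IsLocalization.mk'_surjective (PHat P happrox).primeCompl b
  have hs : theta P happrox s ≠ 0 := s.2
  obtain ⟨a, ha⟩ := hsurjP (theta P happrox t * (theta P happrox s)⁻¹)
  refine ⟨a, ?_⟩
  have hmem : t - a • (s : Ah ⊗[A] R') ∈ PHat P happrox := by
    rw [mem_PHat_iff, map_sub, map_smul, Algebra.smul_def, ha, mul_assoc, inv_mul_cancel₀ hs,
      mul_one, sub_self]
  have hunit : IsUnit (algebraMap (Ah ⊗[A] R') (Bpp P happrox) s) := IsLocalization.map_units _ s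
  have key : (IsLocalization.mk' (Bpp P happrox) t s - algebraMap A (Bpp P happrox) a) *
      algebraMap (Ah ⊗[A] R') (Bpp P happrox) s =
      algebraMap (Ah ⊗[A] R') (Bpp P happrox) (t - a • (s : Ah ⊗[A] R')) := by
    rw [sub_mul, IsLocalization.mk'_spec, map_sub, Algebra.smul_def, map_mul,
      ← IsScalarTower.algebraMap_apply]
  rw [← Ideal.mul_unit_mem_iff_mem _ hunit, key]
  exact (IsLocalization.AtPrime.to_map_mem_maximal_iff (Bpp P happrox) (PHat P happrox) _).mpr hmem

end Setting

/-! ## `B''` is an étale local algebra over `Ah`: regular, `𝔪_{B''} = 𝔪_{Ah} B''`, same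
dimension; and it is flat and local over `A' = R'_P` -/

section BppRegular

variable {A : Type u} [CommRing A] [IsLocalRing A]
variable {Ah : Type u} [CommRing Ah] [Algebra A Ah] [IsRegularLocalRing Ah]
  [IsLocalHom (algebraMap A Ah)]
variable {R' : Type u} [CommRing R'] [Algebra A R'] (P : Ideal R') [P.IsPrime]
  [P.LiesOver (maximalIdeal A)]
variable (happrox : ∀ y : Ah, ∃ a : A, y - algebraMap A Ah a ∈ maximalIdeal Ah)

/-- `P̂ ∩ Ah = 𝔪_{Ah}` (`Ideal.under` form). [folklore] -/
theorem under_PHat_eq : (PHat P happrox).under Ah = maximalIdeal Ah :=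
  comap_PHat_left P happrox

/-- A local ring is its own localisation at the maximal ideal. [folklore] -/
theorem isLocalizationAtPrime_self (L : Type*) [CommRing L] [IsLocalRing L] :
    IsLocalization.AtPrime L (maximalIdeal L) :=
  IsLocalization.of_le_isUnit fun x hx => by
    change IsUnit x
    have hx' : x ∉ maximalIdeal L := hx
    exact not_not.mp fun h => hx' ((mem_maximalIdeal x).mpr h)

/-- `Ah` is the localisation of `Ah` at `P̂ ∩ Ah = 𝔪_{Ah}`. [folklore] -/
theorem isLocalizationAtPrime_under_PHat :
    IsLocalization.AtPrime Ah ((PHat P happrox).under Ah) :=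
  IsLocalization.of_le_isUnit fun y hy => by
    change IsUnit y
    have hy' : y ∉ (PHat P happrox).under Ah := hy
    rw [under_PHat_eq] at hy'
    exact not_not.mp fun h => hy' ((mem_maximalIdeal y).mpr h)

variable [Algebra.Etale A R']

/-- `B''` is a regular local ring (étale over the regular local ring `Ah`).
[cite: StacksProject, Tag 00TV] -/
theorem isRegularLocalRing_Bpp : IsRegularLocalRing (Bpp P happrox) := by
  haveI := isLocalizationAtPrime_under_PHat P happrox
  exact isRegularLocalRing_of_etale_atPrime (R := Ah) (R' := Ah ⊗[A] R') (PHat P happrox) Ah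
    (Bpp P happrox)

/-- `𝔪_{Ah} B'' = 𝔪_{B''}` (unramified). [cite: StacksProject, Tag 00UW] -/
theorem map_maximalIdeal_Bpp :
    (maximalIdeal Ah).map (algebraMap Ah (Bpp P happrox)) = maximalIdeal (Bpp P happrox) := by
  have h := map_under_eq_maximalIdeal_of_etale_atPrime (R := Ah) (PHat P happrox) (Bpp P happrox)
  rwa [under_PHat_eq, Ideal.map_map, ← IsScalarTower.algebraMap_eq] at h

/-- `dim B'' = dim Ah` (étale). [cite: StacksProject, Tag 00ON] -/
theorem ringKrullDim_Bpp : ringKrullDim (Bpp P happrox) = ringKrullDim Ah := by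
  haveI := isLocalizationAtPrime_under_PHat P happrox
  exact ringKrullDim_eq_of_etale_atPrime (R := Ah) (PHat P happrox) Ah (Bpp P happrox)

end BppRegular

section BppProperties

variable {A : Type u} [CommRing A] [IsLocalRing A]
variable {Ah : Type u} [CommRing Ah] [Algebra A Ah] [IsLocalRing Ah] [IsLocalHom (algebraMap A Ah)]
variable {R' : Type u} [CommRing R'] [Algebra A R'] (P : Ideal R') [P.IsPrime]
  [P.LiesOver (maximalIdeal A)]
variable (happrox : ∀ y : Ah, ∃ a : A, y - algebraMap A Ah a ∈ maximalIdeal Ah)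

/-- `R' → B''` as the structure map of an algebra. [folklore] -/
instance algebraRBpp : Algebra R' (Bpp P happrox) := (toBpp P happrox).toRingHom.toAlgebra

/-- The structure map `R' → B''` is `toBpp`. [folklore] -/
theorem algebraMap_R'_Bpp (s : R') : algebraMap R' (Bpp P happrox) s = toBpp P happrox s := rfl

/-- `A → R' → B''` commutes. [folklore] -/
instance isScalarTower_A_R'_Bpp : IsScalarTower A R' (Bpp P happrox) :=
  IsScalarTower.of_algebraMap_eq fun a => ((toBpp P happrox).commutes a).symm

/-- `A' = R'_P → B''` as the structure map of an algebra. [folklore] -/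
instance algebraLocBpp : Algebra (Localization.AtPrime P) (Bpp P happrox) :=
  (locToBpp P happrox).toAlgebra

/-- `R' → A' → B''` commutes. [folklore] -/
instance isScalarTower_R'_loc_Bpp : IsScalarTower R' (Localization.AtPrime P) (Bpp P happrox) :=
  IsScalarTower.of_algebraMap_eq fun s => (locToBpp_algebraMap P happrox s).symm

/-- `A → A' → B''` commutes. [folklore] -/
instance isScalarTower_A_loc_Bpp : IsScalarTower A (Localization.AtPrime P) (Bpp P happrox) :=
  IsScalarTower.of_algebraMap_eq fun a => by
    rw [IsScalarTower.algebraMap_apply A R' (Localization.AtPrime P),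
      ← IsScalarTower.algebraMap_apply R' (Localization.AtPrime P) (Bpp P happrox),
      IsScalarTower.algebraMap_apply A R' (Bpp P happrox)]

/-- `A' → B''` is a local homomorphism. [folklore] -/
instance isLocalHom_algebraMap_loc_Bpp :
    IsLocalHom (algebraMap (Localization.AtPrime P) (Bpp P happrox)) :=
  inferInstanceAs (IsLocalHom (locToBpp P happrox))

/-- `B''` is flat over `R'` (a localisation of the base change `Ah ⊗_A R'` of the flat `A → Ah`).
[folklore] -/
theorem flat_R'_Bpp [Module.Flat A Ah] : Module.Flat R' (Bpp P happrox) := by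
  have h1 : (Algebra.TensorProduct.includeRight (R := A) (A := Ah) (B := R')).toRingHom.Flat := by
    letI : Algebra R' (Ah ⊗[A] R') := Algebra.TensorProduct.rightAlgebra
    exact RingHom.Flat.isStableUnderBaseChange A Ah R' (Ah ⊗[A] R')
      (RingHom.flat_algebraMap_iff.mpr ‹Module.Flat A Ah›)
  have h2 : (algebraMap (Ah ⊗[A] R') (Bpp P happrox)).Flat :=
    RingHom.flat_algebraMap_iff.mpr (IsLocalization.flat (Bpp P happrox) (PHat P happrox).primeCompl)
  have h3 : ((algebraMap (Ah ⊗[A] R') (Bpp P happrox)).comp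
      (Algebra.TensorProduct.includeRight (R := A) (A := Ah) (B := R')).toRingHom).Flat := h1.comp h2
  exact RingHom.flat_algebraMap_iff.mp h3

/-- `B''` is flat over `A' = R'_P`. [folklore] -/
theorem flat_loc_Bpp [Module.Flat A Ah] : Module.Flat (Localization.AtPrime P) (Bpp P happrox) :=
  (Module.flat_iff_of_isLocalization (Localization.AtPrime P) P.primeCompl (Bpp P happrox)).mpr
    (flat_R'_Bpp P happrox)

end BppProperties

/-! ## The branch decomposition of `B'' ⊗_A C` and the projections onto the branches -/

section Branches

variable {A : Type u} [CommRing A] [IsLocalRing A]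
variable {Ah : Type u} [CommRing Ah] [Algebra A Ah] [IsLocalRing Ah] [IsLocalHom (algebraMap A Ah)]
variable {R' : Type u} [CommRing R'] [Algebra A R'] (P : Ideal R') [P.IsPrime]
  [P.LiesOver (maximalIdeal A)]
variable (happrox : ∀ y : Ah, ∃ a : A, y - algebraMap A Ah a ∈ maximalIdeal Ah)
variable {d : ℕ} (x : Fin d → Ah) (r : ℕ)
variable {C : Type u} [CommRing C] [Algebra A C]
variable (Φ : Ah ⊗[A] C ≃ₐ[Ah] BranchProduct x r)

/-- The images `x̄ᵢ` of the formal coordinates in `B''`. [folklore] -/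
def xb (i : Fin d) : Bpp P happrox := algebraMap Ah (Bpp P happrox) (x i)

/-- `(xⱼ) ⊆ Ah` maps into `(x̄ⱼ) ⊆ B''`. [folklore] -/
theorem span_x_le_comap (j : Fin d) :
    Ideal.span {x j} ≤ (Ideal.span {xb P happrox x j}).comap (algebraMap Ah (Bpp P happrox)) := by
  rw [Ideal.span_singleton_le_iff_mem, Ideal.mem_comap]
  exact Ideal.mem_span_singleton_self _

/-- `(xⱼ) B'' = (x̄ⱼ)`. [folklore] -/
theorem map_span_x (j : Fin d) :
    (Ideal.span {x j}).map (algebraMap Ah (Bpp P happrox)) = Ideal.span {xb P happrox x j} := by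
  rw [Ideal.map_span, Set.image_singleton]
  rfl

/-- `Ah/(xⱼ) → B''/(x̄ⱼ)`. [folklore] -/
def quotToBpp (j : Fin d) : Ah ⧸ Ideal.span {x j} →+* Bpp P happrox ⧸ Ideal.span {xb P happrox x j} :=
  Ideal.quotientMap _ (algebraMap Ah (Bpp P happrox)) (span_x_le_comap P happrox x j)

/-- **The branch decomposition `Ψ : B'' ⊗_A C ≅ Π_{j<r} B''/(x̄ⱼ)`**, base change of `Φ` along
`Ah → B''`. [folklore] -/
def Psi : Bpp P happrox ⊗[A] C ≃ₐ[Bpp P happrox]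
    ∀ j : ↥(branchSet d r), Bpp P happrox ⧸ Ideal.span {xb P happrox x j.1} := by
  classical
  exact (Algebra.TensorProduct.cancelBaseChange A Ah (Bpp P happrox) (Bpp P happrox) C).symm.trans
    ((Algebra.TensorProduct.congr (AlgEquiv.refl : Bpp P happrox ≃ₐ[Bpp P happrox] Bpp P happrox)
      Φ).trans
      ((Algebra.TensorProduct.piRight Ah (Bpp P happrox) (Bpp P happrox)
        (fun j : ↥(branchSet d r) => Ah ⧸ Ideal.span {x j.1})).trans
        (AlgEquiv.piCongrRight fun j : ↥(branchSet d r) =>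
          ((Algebra.TensorProduct.quotIdealMapEquivTensorQuot (Bpp P happrox)
            (Ideal.span {x j.1})).symm.trans
            (Ideal.quotientEquivAlgOfEq (Bpp P happrox) (map_span_x P happrox x j.1))))))

/-- The projection `π_j : B'' ⊗_A C → B''/(x̄ⱼ)` onto the `j`-th branch. [folklore] -/
def proj (j : ↥(branchSet d r)) :
    Bpp P happrox ⊗[A] C →ₐ[Bpp P happrox] Bpp P happrox ⧸ Ideal.span {xb P happrox x j.1} :=
  (Pi.evalAlgHom (Bpp P happrox) _ j).comp (Psi P happrox x r Φ).toAlgHom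

/-- Unfolding `proj`. [folklore] -/
theorem proj_apply (j : ↥(branchSet d r)) (z : Bpp P happrox ⊗[A] C) :
    proj P happrox x r Φ j z = Psi P happrox x r Φ z j := rfl

/-- `Ψ (b ⊗ c)_j = ȳ_j · b̄` where `ȳ_j = Φ(1 ⊗ c)_j`. [folklore] -/
theorem Psi_tmul (b : Bpp P happrox) (c : C) (j : ↥(branchSet d r)) {y : Ah}
    (hy : Ideal.Quotient.mk _ y = Φ (1 ⊗ₜ c) j) :
    Psi P happrox x r Φ (b ⊗ₜ c) j = Ideal.Quotient.mk _ (y • b) := by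
  classical
  simp only [Psi, AlgEquiv.trans_apply, Algebra.TensorProduct.cancelBaseChange_symm_tmul,
    Algebra.TensorProduct.congr_apply, Algebra.TensorProduct.map_tmul,
    Algebra.TensorProduct.piRight_tmul, AlgEquiv.piCongrRight_apply]
  have hy' : (Φ : Ah ⊗[A] C →ₐ[Ah] BranchProduct x r) (1 ⊗ₜ c) j = Ideal.Quotient.mk _ y := hy.symm
  erw [hy']
  rfl

/-- `π_j (b ⊗ c) = ȳ_j · b̄`. [folklore] -/
theorem proj_tmul (b : Bpp P happrox) (c : C) (j : ↥(branchSet d r)) {y : Ah}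
    (hy : Ideal.Quotient.mk _ y = Φ (1 ⊗ₜ c) j) :
    proj P happrox x r Φ j (b ⊗ₜ c) =
      Ideal.Quotient.mk _ (algebraMap Ah (Bpp P happrox) y * b) := by
  rw [proj_apply, Psi_tmul P happrox x r Φ b c j hy, Algebra.smul_def]

/-- `π_j (1 ⊗ c)` is the image of the `j`-th component of `Φ(1 ⊗ c)`. [folklore] -/
theorem proj_one_tmul (j : ↥(branchSet d r)) (c : C) :
    proj P happrox x r Φ j (1 ⊗ₜ c) = quotToBpp P happrox x j.1 (Φ (1 ⊗ₜ c) j) := by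
  obtain ⟨y, hy⟩ := Ideal.Quotient.mk_surjective (Φ (1 ⊗ₜ[A] c) j)
  rw [proj_tmul P happrox x r Φ 1 c j hy, mul_one, ← hy]
  rfl

/-- The projections jointly detect `0`. [folklore] -/
theorem eq_zero_of_forall_proj_eq_zero {z : Bpp P happrox ⊗[A] C}
    (h : ∀ j, proj P happrox x r Φ j z = 0) : z = 0 := by
  have : Psi P happrox x r Φ z = 0 := funext h
  exact (EmbeddingLike.map_eq_zero_iff).mp this

/-- The projections are jointly onto. [folklore] -/
theorem exists_forall_proj_eq (v : ∀ j : ↥(branchSet d r), Bpp P happrox ⧸ Ideal.span {xb P happrox x j.1}) :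
    ∃ z, ∀ j, proj P happrox x r Φ j z = v j := by
  obtain ⟨z, hz⟩ := (Psi P happrox x r Φ).surjective v
  exact ⟨z, fun j => by rw [proj_apply, hz]⟩

end Branches

/-! ## The branch points of `B'' ⊗_A C` and of `C` -/

section BranchPoints

variable {A : Type u} [CommRing A] [IsLocalRing A]
variable {Ah : Type u} [CommRing Ah] [Algebra A Ah] [IsLocalRing Ah] [IsLocalHom (algebraMap A Ah)]
variable {R' : Type u} [CommRing R'] [Algebra A R'] (P : Ideal R') [P.IsPrime]
  [P.LiesOver (maximalIdeal A)]
variable (happrox : ∀ y : Ah, ∃ a : A, y - algebraMap A Ah a ∈ maximalIdeal Ah)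
variable {d : ℕ} (x : Fin d → Ah) (r : ℕ)
variable {C : Type u} [CommRing C] [Algebra A C]
variable (Φ : Ah ⊗[A] C ≃ₐ[Ah] BranchProduct x r)

/-- `Ah → B''` is local: `𝔪_{Ah}` maps into `𝔪_{B''}`. [folklore] -/
theorem algebraMap_mem_maximalIdeal_Bpp {y : Ah} (hy : y ∈ maximalIdeal Ah) :
    algebraMap Ah (Bpp P happrox) y ∈ maximalIdeal (Bpp P happrox) := by
  rw [IsScalarTower.algebraMap_apply Ah (Ah ⊗[A] R') (Bpp P happrox),
    IsLocalization.AtPrime.to_map_mem_maximal_iff (Bpp P happrox) (PHat P happrox),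
    ← Ideal.mem_comap, comap_PHat_left]
  exact hy

variable (hx : ∀ i, x i ∈ maximalIdeal Ah)

include hx in
/-- `x̄ᵢ ∈ 𝔪_{B''}`. [folklore] -/
theorem xb_mem_maximalIdeal (i : Fin d) : xb P happrox x i ∈ maximalIdeal (Bpp P happrox) :=
  algebraMap_mem_maximalIdeal_Bpp P happrox (hx i)

include hx in
/-- `(x̄ᵢ) ⊆ 𝔪_{B''}`. [folklore] -/
theorem span_xb_le_maximalIdeal (i : Fin d) :
    Ideal.span {xb P happrox x i} ≤ maximalIdeal (Bpp P happrox) :=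
  (Ideal.span_singleton_le_iff_mem _).mpr (xb_mem_maximalIdeal P happrox x hx i)

/-- The residue projection `π̃_j : B'' ⊗_A C → B''/(x̄ⱼ) → κ(B'')`. [folklore] -/
def projRes (j : ↥(branchSet d r)) : Bpp P happrox ⊗[A] C →+* ResidueField (Bpp P happrox) :=
  (Ideal.Quotient.factor (span_xb_le_maximalIdeal P happrox x hx j.1)).comp
    (proj P happrox x r Φ j).toRingHom

/-- Unfolding `projRes`. [folklore] -/
theorem projRes_apply (j : ↥(branchSet d r)) (z : Bpp P happrox ⊗[A] C) :
    projRes P happrox x r Φ hx j z =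
      Ideal.Quotient.factor (span_xb_le_maximalIdeal P happrox x hx j.1)
        (proj P happrox x r Φ j z) := rfl

/-- `B''/(x̄ᵢ) → κ(B'')` on classes is the residue map. [folklore] -/
theorem factor_mk_eq_residue (i : Fin d) (b : Bpp P happrox) :
    Ideal.Quotient.factor (span_xb_le_maximalIdeal P happrox x hx i) (Ideal.Quotient.mk _ b) =
      residue (Bpp P happrox) b := rfl

/-- `π̃_j (b ⊗ 1) = b̄`. [folklore] -/
theorem projRes_tmul_one (j : ↥(branchSet d r)) (b : Bpp P happrox) :
    projRes P happrox x r Φ hx j (b ⊗ₜ 1) = residue (Bpp P happrox) b := by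
  rw [projRes_apply]
  have : (b ⊗ₜ[A] (1 : C)) = algebraMap (Bpp P happrox) (Bpp P happrox ⊗[A] C) b := rfl
  rw [this, AlgHom.commutes]
  rfl

/-- The base change `τ : R' ⊗_A C → B'' ⊗_A C` of `R' → B''`. [folklore] -/
def tau : R' ⊗[A] C →ₐ[A] Bpp P happrox ⊗[A] C :=
  Algebra.TensorProduct.map (toBpp P happrox) (AlgHom.id A C)

/-- `τ(s ⊗ c) = s̄ ⊗ c`. [folklore] -/
theorem tau_tmul (s : R') (c : C) : tau P happrox (C := C) (s ⊗ₜ c) = toBpp P happrox s ⊗ₜ c :=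
  Algebra.TensorProduct.map_tmul _ _ s c

/-- The branch point `Q_j ⊂ R' ⊗_A C`: the pull-back of the `j`-th branch point of
`B'' ⊗_A C`. [folklore] -/
def Qb (j : ↥(branchSet d r)) : Ideal (R' ⊗[A] C) :=
  RingHom.ker ((projRes P happrox x r Φ hx j).comp (tau P happrox).toRingHom)

/-- Membership in `Q_j`. [folklore] -/
theorem mem_Qb_iff (j : ↥(branchSet d r)) (m : R' ⊗[A] C) :
    m ∈ Qb P happrox x r Φ hx j ↔ projRes P happrox x r Φ hx j (tau P happrox m) = 0 := Iff.rfl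

/-- `Q_j` is prime. [folklore] -/
instance isPrime_Qb (j : ↥(branchSet d r)) : (Qb P happrox x r Φ hx j).IsPrime :=
  RingHom.ker_isPrime _

/-- `Q_j` lies over `P`. [folklore] -/
instance liesOver_Qb (j : ↥(branchSet d r)) : (Qb P happrox x r Φ hx j).LiesOver P := by
  refine ⟨le_antisymm (fun s hs => ?_) (fun s hs => ?_)⟩
  · rw [Ideal.under_def, Ideal.mem_comap, Algebra.TensorProduct.algebraMap_apply,
      Algebra.algebraMap_self, RingHom.id_apply, mem_Qb_iff, tau_tmul,
      ← algebraMap_R'_Bpp, projRes_tmul_one, residue_eq_zero_iff, algebraMap_R'_Bpp, toBpp_apply,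
      IsLocalization.AtPrime.to_map_mem_maximal_iff (Bpp P happrox) (PHat P happrox),
      ← comap_PHat_right P happrox] at *
    exact hs
  · rw [Ideal.under_def, Ideal.mem_comap, Algebra.TensorProduct.algebraMap_apply,
      Algebra.algebraMap_self, RingHom.id_apply, mem_Qb_iff, tau_tmul,
      ← algebraMap_R'_Bpp, projRes_tmul_one, residue_eq_zero_iff, algebraMap_R'_Bpp, toBpp_apply,
      IsLocalization.AtPrime.to_map_mem_maximal_iff (Bpp P happrox) (PHat P happrox)] at hs
    rw [← comap_PHat_right P happrox]
    exact hs

/-- The branch point `𝔫_j ⊂ C`. [folklore] -/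
def nb (j : ↥(branchSet d r)) : Ideal C :=
  RingHom.ker ((projRes P happrox x r Φ hx j).comp
    (Algebra.TensorProduct.includeRight (R := A) (A := Bpp P happrox)).toRingHom)

/-- Membership in `𝔫_j`. [folklore] -/
theorem mem_nb_iff (j : ↥(branchSet d r)) (c : C) :
    c ∈ nb P happrox x r Φ hx j ↔ projRes P happrox x r Φ hx j (1 ⊗ₜ c) = 0 := Iff.rfl

/-- `Q_j ∩ C = 𝔫_j`. [folklore] -/
theorem comap_Qb_includeRight (j : ↥(branchSet d r)) :
    (Qb P happrox x r Φ hx j).comap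
      (Algebra.TensorProduct.includeRight (R := A) (A := R')).toRingHom = nb P happrox x r Φ hx j := by
  ext c
  rw [Ideal.mem_comap, AlgHom.toRingHom_eq_coe, AlgHom.coe_toRingHom,
    Algebra.TensorProduct.includeRight_apply, mem_Qb_iff, tau_tmul, map_one, mem_nb_iff]

/-- Every element of `B'' ⊗_A C` has the same residues `π̃_j` as an element `1 ⊗ c`.
[folklore] -/
theorem exists_forall_projRes_eq (hsurjP : Function.Surjective (algebraMap A P.ResidueField))
    (z : Bpp P happrox ⊗[A] C) :
    ∃ c : C, ∀ j, projRes P happrox x r Φ hx j z = projRes P happrox x r Φ hx j (1 ⊗ₜ c) := by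
  induction z using TensorProduct.induction_on with
  | zero => exact ⟨0, fun j => by rw [TensorProduct.tmul_zero]⟩
  | tmul b c₀ =>
    obtain ⟨a, ha⟩ := exists_sub_algebraMap_mem_maximalIdeal_Bpp P happrox hsurjP b
    refine ⟨a • c₀, fun j => ?_⟩
    have h1 : (b ⊗ₜ[A] c₀ : Bpp P happrox ⊗[A] C) = (b ⊗ₜ 1) * (1 ⊗ₜ c₀) := by
      rw [Algebra.TensorProduct.tmul_mul_tmul, mul_one, one_mul]
    have h2 : ((1 : Bpp P happrox) ⊗ₜ[A] (a • c₀) : Bpp P happrox ⊗[A] C) =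
        (algebraMap A (Bpp P happrox) a ⊗ₜ 1) * (1 ⊗ₜ c₀) := by
      rw [Algebra.TensorProduct.tmul_mul_tmul, mul_one, one_mul, ← TensorProduct.smul_tmul,
        Algebra.algebraMap_eq_smul_one]
    have h3 : residue (Bpp P happrox) b = residue (Bpp P happrox) (algebraMap A (Bpp P happrox) a) := by
      rw [← sub_eq_zero, ← map_sub, residue_eq_zero_iff]
      exact ha
    rw [h1, h2, map_mul, map_mul, projRes_tmul_one, projRes_tmul_one, h3]
  | add z₁ z₂ h₁ h₂ =>
    obtain ⟨c₁, hc₁⟩ := h₁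
    obtain ⟨c₂, hc₂⟩ := h₂
    exact ⟨c₁ + c₂, fun j => by rw [map_add, hc₁ j, hc₂ j, TensorProduct.tmul_add, map_add]⟩

/-- **The branch points of `C` are pairwise distinct.** [folklore] -/
theorem nb_injective (hsurjP : Function.Surjective (algebraMap A P.ResidueField)) :
    Function.Injective (nb P happrox x r Φ hx) := by
  classical
  intro j l hjl
  by_contra hne
  obtain ⟨z, hz⟩ := exists_forall_proj_eq P happrox x r Φ (Pi.single j 1)
  obtain ⟨c, hc⟩ := exists_forall_projRes_eq P happrox x r Φ hx hsurjP z
  have hj : projRes P happrox x r Φ hx j (1 ⊗ₜ c) = 1 := by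
    rw [← hc j, projRes_apply, hz j, Pi.single_eq_same, map_one]
    rfl
  have hl : projRes P happrox x r Φ hx l (1 ⊗ₜ c) = 0 := by
    rw [← hc l, projRes_apply, hz l, Pi.single_eq_of_ne (Ne.symm hne), map_zero]
    rfl
  have hcl : c ∈ nb P happrox x r Φ hx l := hl
  rw [← hjl] at hcl
  rw [mem_nb_iff, hj] at hcl
  exact one_ne_zero hcl

end BranchPoints

/-! ## Idempotents and the branches they cut out -/

/-- An idempotent of a local ring is `0` or `1`. [folklore] -/
theorem IsIdempotentElem.eq_zero_or_eq_one_of_isLocalRing {L : Type*} [CommRing L] [IsLocalRing L]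
    {a : L} (h : IsIdempotentElem a) : a = 0 ∨ a = 1 := by
  rcases IsLocalRing.isUnit_or_isUnit_one_sub_self a with hu | hu
  · right
    have h1 : a * a = a * 1 := by rw [mul_one]; exact h.eq
    exact hu.mul_left_cancel h1
  · left
    have h1 : (1 - a) * a = (1 - a) * 0 := by rw [mul_zero, sub_mul, one_mul, h.eq, sub_self]
    exact hu.mul_left_cancel h1

section Descent

variable {A : Type u} [CommRing A] [IsLocalRing A]
variable {Ah : Type u} [CommRing Ah] [Algebra A Ah] [IsLocalRing Ah] [IsLocalHom (algebraMap A Ah)]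
variable {R' : Type u} [CommRing R'] [Algebra A R'] (P : Ideal R') [P.IsPrime]
  [P.LiesOver (maximalIdeal A)]
variable (happrox : ∀ y : Ah, ∃ a : A, y - algebraMap A Ah a ∈ maximalIdeal Ah)
variable {d : ℕ} (x : Fin d → Ah) (r : ℕ)
variable {C : Type u} [CommRing C] [Algebra A C]
variable (Φ : Ah ⊗[A] C ≃ₐ[Ah] BranchProduct x r)
variable (hx : ∀ i, x i ∈ maximalIdeal Ah)

include hx in
/-- The components of an idempotent of `B'' ⊗_A C` on the (local) branches are `0` or `1`.
[folklore] -/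
theorem proj_eq_zero_or_eq_one {ε : Bpp P happrox ⊗[A] C} (hε : IsIdempotentElem ε)
    (l : ↥(branchSet d r)) : proj P happrox x r Φ l ε = 0 ∨ proj P happrox x r Φ l ε = 1 := by
  haveI := isLocalRing_quotient_span_of_mem_maximalIdeal (xb_mem_maximalIdeal P happrox x hx l.1)
  exact IsIdempotentElem.eq_zero_or_eq_one_of_isLocalRing
    (L := Bpp P happrox ⧸ Ideal.span {xb P happrox x l.1}) (hε.map (proj P happrox x r Φ l))

/-- For an idempotent, `π̃_l ε ≠ 0` iff `π_l ε = 1`. [folklore] -/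
theorem projRes_ne_zero_iff {ε : Bpp P happrox ⊗[A] C} (hε : IsIdempotentElem ε)
    (l : ↥(branchSet d r)) :
    projRes P happrox x r Φ hx l ε ≠ 0 ↔ proj P happrox x r Φ l ε = 1 := by
  haveI := isLocalRing_quotient_span_of_mem_maximalIdeal
    (xb_mem_maximalIdeal P happrox x hx l.1)
  rw [projRes_apply]
  rcases proj_eq_zero_or_eq_one P happrox x r Φ hx hε l with h | h
  · rw [h, map_zero]
    exact ⟨fun h1 => absurd rfl h1, fun h1 => absurd h1 zero_ne_one⟩
  · rw [h, map_one]
    change (1 : ResidueField (Bpp P happrox)) ≠ 0 ↔ _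
    exact ⟨fun _ => rfl, fun _ => one_ne_zero⟩

variable {n : ℕ} (e : Fin (n + 1) → R' ⊗[A] C) (he : CompleteOrthogonalIdempotents e)
  (P' : Fin n → Ideal (R' ⊗[A] C))
  (H : ∀ P'' : Ideal (R' ⊗[A] C), P''.IsPrime → P''.LiesOver P →
    e (Fin.last n) ∈ P'' ∧ ∀ i, e i.castSucc ∉ P'' → P'' = P' i)

include hx he H in
/-- **Each branch is cut out by one of the idempotents**: for every `j < r` there is an index
`i₀` such that `ε = τ(e_{i₀})` has `π_j ε = 1` and `π_l ε = 0` for `l ≠ j` (by the uniqueness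
clause of the étale splitting and the distinctness of the branch points of `C`). [folklore] -/
theorem exists_proj_tau_eq (hsurjP : Function.Surjective (algebraMap A P.ResidueField))
    (j : ↥(branchSet d r)) :
    ∃ i₀ : Fin n, proj P happrox x r Φ j (tau P happrox (e i₀.castSucc)) = 1 ∧
      ∀ l, l ≠ j → proj P happrox x r Φ l (tau P happrox (e i₀.castSucc)) = 0 := by
  -- some `e i` lies outside `Q_j`
  have hex : ∃ i, e i ∉ Qb P happrox x r Φ hx j := by
    by_contra h
    push Not at h
    have h1 : ∑ i, e i ∈ Qb P happrox x r Φ hx j := Ideal.sum_mem _ fun i _ => h i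
    rw [he.complete] at h1
    exact (Ideal.IsPrime.ne_top inferInstance) ((Ideal.eq_top_iff_one _).mpr h1)
  obtain ⟨i, hi⟩ := hex
  -- it is not the last one
  obtain ⟨i₀, rfl⟩ | rfl := Fin.eq_castSucc_or_eq_last i
  swap
  · exact absurd (H _ inferInstance inferInstance).1 hi
  have hQ : Qb P happrox x r Φ hx j = P' i₀ := (H _ inferInstance inferInstance).2 i₀ hi
  have hε : IsIdempotentElem (tau P happrox (e i₀.castSucc)) := (he.idem i₀.castSucc).map _
  refine ⟨i₀, ?_, fun l hlj => ?_⟩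
  · exact (projRes_ne_zero_iff P happrox x r Φ hx hε j).mp hi
  · rcases proj_eq_zero_or_eq_one P happrox x r Φ hx hε l with h | h
    · exact h
    · exfalso
      have hl : e i₀.castSucc ∉ Qb P happrox x r Φ hx l :=
        (projRes_ne_zero_iff P happrox x r Φ hx hε l).mpr h
      have hQl : Qb P happrox x r Φ hx l = P' i₀ := (H _ inferInstance inferInstance).2 i₀ hl
      apply hlj
      apply nb_injective P happrox x r Φ hx hsurjP
      rw [← comap_Qb_includeRight, ← comap_Qb_includeRight, hQl, ← hQ]

/-- **The kernel of `B'' → (B'' ⊗_A C)/(1 - ε)` is `(x̄ⱼ)`** when `ε` is the idempotent of the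
`j`-th branch. [folklore] -/
theorem ker_algebraMap_quotient_eq_span (j : ↥(branchSet d r)) {ε : Bpp P happrox ⊗[A] C}
    (hj : proj P happrox x r Φ j ε = 1) (hl : ∀ l, l ≠ j → proj P happrox x r Φ l ε = 0) :
    RingHom.ker (algebraMap (Bpp P happrox) ((Bpp P happrox ⊗[A] C) ⧸ Ideal.span {1 - ε})) =
      Ideal.span {xb P happrox x j.1} := by
  ext b
  rw [RingHom.mem_ker, IsScalarTower.algebraMap_apply (Bpp P happrox) (Bpp P happrox ⊗[A] C),
    Ideal.Quotient.algebraMap_eq, Ideal.Quotient.eq_zero_iff_mem, Ideal.mem_span_singleton']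
  constructor
  · rintro ⟨y, hy⟩
    have h1 := congrArg (proj P happrox x r Φ j) hy
    rw [map_mul, map_sub, map_one, hj, sub_self, mul_zero, AlgHom.commutes,
      Ideal.Quotient.algebraMap_eq] at h1
    exact Ideal.Quotient.eq_zero_iff_mem.mp h1.symm
  · intro hb
    refine ⟨algebraMap (Bpp P happrox) _ b, ?_⟩
    rw [mul_sub, mul_one, sub_eq_self]
    apply eq_zero_of_forall_proj_eq_zero P happrox x r Φ
    intro l
    rw [map_mul, AlgHom.commutes, Ideal.Quotient.algebraMap_eq]
    by_cases hlj : l = j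
    · subst hlj
      rw [Ideal.Quotient.eq_zero_iff_mem.mpr hb, zero_mul]
    · rw [hl l hlj, mul_zero]

end Descent

/-! ## The branch ideals are extended from `R'` -/

/-- Isomorphic algebras have the same kernel of the structure map. [folklore] -/
theorem ker_algebraMap_eq_of_algEquiv {R X Y : Type*} [CommSemiring R] [Semiring X] [Semiring Y]
    [Algebra R X] [Algebra R Y] (e : X ≃ₐ[R] Y) :
    RingHom.ker (algebraMap R X) = RingHom.ker (algebraMap R Y) := by
  ext b
  rw [RingHom.mem_ker, RingHom.mem_ker, ← e.commutes b, map_eq_zero_iff e e.injective]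

section Extension

variable {A : Type u} [CommRing A] [IsLocalRing A]
variable {Ah : Type u} [CommRing Ah] [Algebra A Ah] [IsLocalRing Ah] [IsLocalHom (algebraMap A Ah)]
variable {R' : Type u} [CommRing R'] [Algebra A R'] (P : Ideal R') [P.IsPrime]
  [P.LiesOver (maximalIdeal A)]
variable (happrox : ∀ y : Ah, ∃ a : A, y - algebraMap A Ah a ∈ maximalIdeal Ah)
variable {d : ℕ} (x : Fin d → Ah) (r : ℕ)
variable {C : Type u} [CommRing C] [Algebra A C]
variable (Φ : Ah ⊗[A] C ≃ₐ[Ah] BranchProduct x r)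
variable (hx : ∀ i, x i ∈ maximalIdeal Ah)
variable {n : ℕ} (e : Fin (n + 1) → R' ⊗[A] C) (he : CompleteOrthogonalIdempotents e)
  (P' : Fin n → Ideal (R' ⊗[A] C))
  (H : ∀ P'' : Ideal (R' ⊗[A] C), P''.IsPrime → P''.LiesOver P →
    e (Fin.last n) ∈ P'' ∧ ∀ i, e i.castSucc ∉ P'' → P'' = P' i)

/-- `B'' ⊗_{R'} (R' ⊗_A C) ≅ B'' ⊗_A C` sends `1 ⊗ m` to `τ m`. [folklore] -/
theorem cancelBaseChange_one_tmul (m : R' ⊗[A] C) :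
    Algebra.TensorProduct.cancelBaseChange A R' (Bpp P happrox) (Bpp P happrox) C (1 ⊗ₜ m) =
      tau P happrox m := by
  induction m using TensorProduct.induction_on with
  | zero => rw [TensorProduct.tmul_zero, map_zero, map_zero]
  | tmul s c =>
    rw [Algebra.TensorProduct.cancelBaseChange_tmul, tau_tmul, ← algebraMap_R'_Bpp,
      Algebra.algebraMap_eq_smul_one]
  | add m₁ m₂ h₁ h₂ => rw [TensorProduct.tmul_add, map_add, map_add, h₁, h₂]

include Φ hx he H in
/-- **The branch ideals `(x̄ⱼ) ⊂ B''` are extended from `R'`**: with `ε₀ = e_{i₀}` the idempotent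
of the `j`-th branch and `D = (R' ⊗_A C)/(1 - ε₀)`, the kernel `𝔞` of `R' → D` extends to the
kernel of `B'' → B'' ⊗_{R'} D ≅ (B'' ⊗_A C)/(1 - τ ε₀)`, which is `(x̄ⱼ)` (flatness of `R' → B''`).
[folklore] -/
theorem exists_ideal_map_eq_span_xb [Module.Flat A Ah]
    (hsurjP : Function.Surjective (algebraMap A P.ResidueField)) (j : ↥(branchSet d r)) :
    ∃ 𝔞 : Ideal R', 𝔞.map (algebraMap R' (Bpp P happrox)) = Ideal.span {xb P happrox x j.1} := by
  obtain ⟨i₀, hj, hl⟩ := exists_proj_tau_eq P happrox x r Φ hx e he P' H hsurjP j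
  haveI := flat_R'_Bpp P happrox
  let J : Ideal (R' ⊗[A] C) := Ideal.span {1 - e i₀.castSucc}
  refine ⟨RingHom.ker (algebraMap R' ((R' ⊗[A] C) ⧸ J)), ?_⟩
  rw [← ker_algebraMap_tensorProduct_of_flat, ← ker_algebraMap_quotient_eq_span P happrox x r Φ j hj hl]
  -- `B'' ⊗_{R'} (R' ⊗_A C)/J ≅ (B'' ⊗_A C)/(1 - τ ε₀)` over `B''`
  refine ker_algebraMap_eq_of_algEquiv
    ((Algebra.TensorProduct.tensorQuotientEquiv (R := R') (Bpp P happrox) (R' ⊗[A] C)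
      (Bpp P happrox) J).trans
      (Ideal.quotientEquivAlg _ _
        (Algebra.TensorProduct.cancelBaseChange A R' (Bpp P happrox) (Bpp P happrox) C) ?_))
  have hJ : Ideal.map (Algebra.TensorProduct.includeRight (R := R') (A := Bpp P happrox)
      (B := R' ⊗[A] C)) J =
      Ideal.span {(1 : Bpp P happrox) ⊗ₜ[R'] (1 - e i₀.castSucc)} := by
    rw [Ideal.map_span, Set.image_singleton]
    rfl
  have key : Algebra.TensorProduct.cancelBaseChange A R' (Bpp P happrox) (Bpp P happrox) C
      ((1 : Bpp P happrox) ⊗ₜ[R'] (1 - e i₀.castSucc)) = 1 - tau P happrox (e i₀.castSucc) := by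
    rw [TensorProduct.tmul_sub, map_sub, cancelBaseChange_one_tmul, cancelBaseChange_one_tmul,
      map_one]
  symm
  rw [hJ, Ideal.map_span, Set.image_singleton]
  congr 1
  congr 1

end Extension

/-! ## Assembly: strict normal crossings in the étale neighbourhood -/

section Assembly

variable {A : Type u} [CommRing A] [IsLocalRing A] [IsNoetherianRing A]
variable {Ah : Type u} [CommRing Ah] [Algebra A Ah] [IsRegularLocalRing Ah] [Module.Flat A Ah]
  [IsLocalHom (algebraMap A Ah)]
variable (happrox : ∀ y : Ah, ∃ a : A, y - algebraMap A Ah a ∈ maximalIdeal Ah)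
variable {d : ℕ} (x : Fin d → Ah) (hspan : Ideal.span (Set.range x) = maximalIdeal Ah)
  (hdim : ringKrullDim Ah = d) {r : ℕ} (hr : 1 ≤ r) (hrd : r ≤ d)
variable {C : Type u} [CommRing C] [Algebra A C]
variable (Φ : Ah ⊗[A] C ≃ₐ[Ah] BranchProduct x r)
variable (I : Ideal A) (hI : I.map (algebraMap A Ah) = Ideal.span {branchProd x r})

/-- The union of the first `r` and the last `d - r` members of a `Fin d`-family is its range.
[folklore] -/
theorem range_castLE_union_range_natAdd {α : Type*} {d r : ℕ} (hrd : r ≤ d) (f : Fin d → α) :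
    Set.range (fun i : Fin r => f (Fin.castLE hrd i)) ∪
      Set.range (fun i : Fin (d - r) => f (Fin.cast (Nat.add_sub_cancel' hrd) (Fin.natAdd r i))) =
      Set.range f := by
  ext a
  simp only [Set.mem_union, Set.mem_range]
  constructor
  · rintro (⟨i, rfl⟩ | ⟨i, rfl⟩)
    · exact ⟨_, rfl⟩
    · exact ⟨_, rfl⟩
  · rintro ⟨i, rfl⟩
    by_cases hi : (i : ℕ) < r
    · exact Or.inl ⟨⟨i, hi⟩, by congr 1⟩
    · refine Or.inr ⟨⟨i - r, by omega⟩, ?_⟩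
      congr 1
      ext
      simp only [Fin.val_cast, Fin.natAdd_mk]
      omega

include happrox hspan hdim hr hrd Φ hI in
/-- **Strict normal crossings in the étale neighbourhood, from splitting data.** Given an étale
`A`-algebra `R'`, a prime `P` over `𝔪_A` with `A → κ(P)` onto, and complete orthogonal
idempotents of `R' ⊗_A C` separating the points over `P` (the output of the étale splitting of
the finite `A`-algebra `C`, Stacks 00UL), the ideal `I R'_P` has local strict normal crossings
data: the branches `(x̄ⱼ)` of `I B'' = (x̄₁ ⋯ x̄_r)` in the regular local ring
`B'' = (Ah ⊗_A R')_{P̂}`, flat and local over `R'_P`, are extended from `R'_P`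
(`exists_ideal_map_eq_span_xb`), so strict normal crossings descend (`exists_rsop_prod_of_flat`).
[folklore] -/
theorem isSNCIdeal_map_of_splitting {R' : Type u} [CommRing R'] [Algebra A R'] [Algebra.Etale A R']
    (P : Ideal R') [P.IsPrime] [P.LiesOver (maximalIdeal A)]
    (hsurjP : Function.Surjective (algebraMap A P.ResidueField))
    {n : ℕ} (e : Fin (n + 1) → R' ⊗[A] C) (he : CompleteOrthogonalIdempotents e)
    (P' : Fin n → Ideal (R' ⊗[A] C))
    (H : ∀ P'' : Ideal (R' ⊗[A] C), P''.IsPrime → P''.LiesOver P →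
      e (Fin.last n) ∈ P'' ∧ ∀ i, e i.castSucc ∉ P'' → P'' = P' i) :
    IsSNCIdeal (I.map (algebraMap A (Localization.AtPrime P))) := by
  classical
  have hx : ∀ i, x i ∈ maximalIdeal Ah := fun i => hspan ▸ Ideal.subset_span ⟨i, rfl⟩
  haveI hregB := isRegularLocalRing_Bpp P happrox
  haveI := flat_loc_Bpp P happrox
  haveI : Algebra.FiniteType A R' := inferInstance
  haveI : IsNoetherianRing R' := Algebra.FiniteType.isNoetherianRing A R'
  haveI : IsNoetherianRing (Localization.AtPrime P) :=
    IsLocalization.isNoetherianRing P.primeCompl _ inferInstance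
  -- the regular system of parameters of `B''`
  let xb' : Fin r → Bpp P happrox := fun i => xb P happrox x (Fin.castLE hrd i)
  let yb' : Fin (d - r) → Bpp P happrox := fun i =>
    xb P happrox x (Fin.cast (Nat.add_sub_cancel' hrd) (Fin.natAdd r i))
  have hdimB : ringKrullDim (Bpp P happrox) = (r + (d - r) : ℕ) := by
    rw [ringKrullDim_Bpp, hdim, Nat.add_sub_cancel' hrd]
  have hspanB : Ideal.span (Set.range xb' ∪ Set.range yb') = maximalIdeal (Bpp P happrox) := by
    rw [range_castLE_union_range_natAdd hrd (xb P happrox x), ← map_maximalIdeal_Bpp P happrox,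
      ← hspan, Ideal.map_span, ← Set.range_comp]
    rfl
  -- the ideal
  have hI' : (I.map (algebraMap A (Localization.AtPrime P))).map
      (algebraMap (Localization.AtPrime P) (Bpp P happrox)) = Ideal.span {∏ i, xb' i} := by
    rw [Ideal.map_map, ← IsScalarTower.algebraMap_eq, IsScalarTower.algebraMap_eq A Ah (Bpp P happrox),
      ← Ideal.map_map, hI, Ideal.map_span, Set.image_singleton, branchProd, map_prod]
    simp only [branchSet, Finset.prod_filter_val_lt hrd]
    rfl
  -- the branches descend
  have hdesc : ∀ i : Fin r, ((Ideal.span {xb' i}).comap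
      (algebraMap (Localization.AtPrime P) (Bpp P happrox))).map
        (algebraMap (Localization.AtPrime P) (Bpp P happrox)) = Ideal.span {xb' i} := by
    intro i
    have hmem : Fin.castLE hrd i ∈ branchSet d r := mem_branchSet_iff.mpr i.2
    obtain ⟨𝔞, h𝔞⟩ := exists_ideal_map_eq_span_xb P happrox x r Φ hx e he P' H hsurjP
      ⟨Fin.castLE hrd i, hmem⟩
    refine le_antisymm Ideal.map_comap_le ?_
    have h1 : (𝔞.map (algebraMap R' (Localization.AtPrime P))).map
        (algebraMap (Localization.AtPrime P) (Bpp P happrox)) = Ideal.span {xb' i} := by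
      rw [Ideal.map_map, ← IsScalarTower.algebraMap_eq]
      exact h𝔞
    calc Ideal.span {xb' i} = _ := h1.symm
      _ ≤ _ := Ideal.map_mono (Ideal.map_le_iff_le_comap.mp (le_of_eq h1))
  obtain ⟨hregA, e', x', y', hdimA, hspanA, hIx, -⟩ :=
    exists_rsop_prod_of_flat (A := Localization.AtPrime P) (B := Bpp P happrox) xb' yb' hdimB hspanB
      (I.map (algebraMap A (Localization.AtPrime P))) hI' hdesc
  exact ⟨hregA, r, e', x', y', hr, hdimA, hspanA, hIx⟩

end Assembly

/-! ## The theorem -/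

/-- **Étale-local strict normal crossings from a formal branch decomposition.** Let `A` be a
Noetherian local ring, `Ah` a regular local `A`-algebra which is flat with `𝔪_A`-local structure
map and the same residue field (every element of `Ah` is congruent to an element of `A`; e.g. the
completion `Â`), `x₁, …, x_d` a regular system of parameters of `Ah` (`dim Ah = d`), `1 ≤ r ≤ d`,
`C` a finite `A`-algebra with an `Ah`-isomorphism `Ah ⊗_A C ≅ Π_{j<r} Ah/(xⱼ)` (the generic chart
of the blow-up of the double locus, `branchModelEquiv`), and `I ⊆ A` an ideal with
`I Ah = (x₁ ⋯ x_r)`. Then there are an étale `A`-algebra `R'` and a prime `P` of `R'` over `𝔪_A`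
with trivial residue extension such that `I R'_P` has local strict normal crossings data
(`IsSNCIdeal`): the étale splitting of `C` (Mathlib's
`Algebra.exists_etale_completeOrthogonalIdempotents_forall_liesOver_eq`, Stacks 00UL) provides
the data of `isSNCIdeal_map_of_splitting`. [cite: StacksProject, Tag 00UL] -/
theorem exists_etale_isSNCIdeal_of_branchDecomposition
    {A : Type u} [CommRing A] [IsLocalRing A] [IsNoetherianRing A]
    {Ah : Type u} [CommRing Ah] [Algebra A Ah] [IsRegularLocalRing Ah] [Module.Flat A Ah]
    [IsLocalHom (algebraMap A Ah)]
    (happrox : ∀ y : Ah, ∃ a : A, y - algebraMap A Ah a ∈ maximalIdeal Ah)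
    {d : ℕ} (x : Fin d → Ah) (hspan : Ideal.span (Set.range x) = maximalIdeal Ah)
    (hdim : ringKrullDim Ah = d) {r : ℕ} (hr : 1 ≤ r) (hrd : r ≤ d)
    {C : Type u} [CommRing C] [Algebra A C] [Module.Finite A C]
    (Φ : Ah ⊗[A] C ≃ₐ[Ah] BranchProduct x r)
    (I : Ideal A) (hI : I.map (algebraMap A Ah) = Ideal.span {branchProd x r}) :
    ∃ (R' : Type u) (_ : CommRing R') (_ : Algebra A R') (_ : Algebra.Etale A R') (P : Ideal R')
      (_ : P.IsPrime) (_ : P.LiesOver (maximalIdeal A)),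
      Function.Surjective (algebraMap A P.ResidueField) ∧
        IsSNCIdeal (I.map (algebraMap A (Localization.AtPrime P))) := by
  obtain ⟨R', _, _, _, P, _, _, n, e, he, P', _, _, hbij, -, H⟩ :=
    Algebra.exists_etale_completeOrthogonalIdempotents_forall_liesOver_eq (R := A) (S := C)
      (maximalIdeal A)
  have hsurjP : Function.Surjective (algebraMap A P.ResidueField) := by
    intro z
    obtain ⟨y, rfl⟩ := hbij.2 z
    obtain ⟨a, rfl⟩ := Ideal.algebraMap_residueField_surjective (maximalIdeal A) y
    exact ⟨a, (AlgHom.commutes _ a).symm⟩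
  exact ⟨R', _, _, ‹_›, P, ‹_›, ‹_›, hsurjP,
    isSNCIdeal_map_of_splitting happrox x hspan hdim hr hrd Φ I hI P hsurjP e he P' H⟩

end Literature.AlgebraicGeometry.Resolution

end
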